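import Literature.MathematicalPhysics.QuantumFieldTheory.Balaban1983to89.B5Eq123Torus
import Literature.MathematicalPhysics.QuantumFieldTheory.Balaban1983to89.B5Eq147Landau
import Literature.MathematicalPhysics.QuantumFieldTheory.Balaban1983to89.B5Gamma1FailsLargeA
import Literature.MathematicalPhysics.QuantumFieldTheory.Balaban1983to89.B5Prop11Fiber

/-!
# `Balaban1983to89.B5Carve43SectsADHyp` — [Balaban1984PropagatorsI] pp. 17–27 (Introduction; Sect. A «An action, its
# symmetries, and a renormalization transformation» (1.1)–(1.15); Sect. B «Compositions of renormalization
# transformations. Basic sequence of actions» (1.16)–(1.20); Sect. C «Change of gauge» (1.21)–(1.45); Sect. D «Operators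
# H_k and a calculation of the actions», first part (1.46)–(1.58)): P6 CARVING-FAN BLOCK 43 — the block's two residual
# printed statements (p. 24) in hypothesis form, BOTH PROVED, and ONE hypothesis bundle `Hyp` of the pages' printed
# statements BY NAME, keyed to the consumer (`stmt-QuantumFields-20542`, K1⁷; also-feeds 20544), itself a THEOREM at the
# tree's torus carriers (`hyp_torusForm`, d ≥ 2, a ≦ 1).  v1.1 (M-c3-2 of `carve/CHECK-3.md`, repair (A) cite + drop): v1's
# §1 re-typed the p. 20 product sentence that the tree PROVES in `B5Eq119ZProduct` — withdrawn and cited; nothing else changed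

statement-level skeleton of published theorems with citation tags; proofs where landed; nothing here is a claim about the
Yang–Mills mass gap

T. Bałaban, *Propagators and renormalization transformations for lattice gauge theories. I*, Commun. Math. Phys. **95**
(1984) 17–40, doi:10.1007/bf01215753 `[Balaban1984PropagatorsI]` (cell paper "B5"; journal page = PDF page + 16; its
references p. 40: [1] = `[Balaban1982Higgs1]`, [2] = `[Balaban1983RegularityDecay]` (B4), [3] = «Renormalization group
methods in non-Abelian gauge theories. Harvard preprint HUTMP B134», [8] = Wilson, Cargèse 1976).
STATUS: published, refereed.  PDF held: `paper:balaban1984-cmp95-propagators-rt-i`; pp. 17–27 [PDF 1–11] read by this seat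
AS IMAGES (renders `run/shared/lean/pub/pub-balaban/b2b-balaban-ref1/pages/1984-cmp95-propagators-rt-I/
1984-cmp95-propagators-rt-I-p001-x2.png` … `-p011-x2.png`, 2026-08-28) and on the text layer (`p0001.txt` … `p0011.txt`;
line locators `pNNNN:Ln` below).  The block ends at (1.58) / p. 27 last line («These calculations lead to the following
result for the minimal configuration»); (1.59) p. 28 opens block 44.

CITATION HEADER (lean-in-tree rule).  Cell `lit-balaban` (HOME `run/shared/lean/pub/lit-balaban/`), P6 CARVING FAN
(D-0154 (3b)), RESERVE block 43 of `carve/BLOCKS-41-48.md` (lead g31 RULING #10; claimed by seat `carve-27`, CLAIM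
`carve/STATUS.md` 08:36:31Z — its own block 27 being in tree): «[B5] Sects. A–D pp. 17–27: action, renormalization
transformations, change of gauge, operators H_k (1.1)–(1.58); 54 SKELETON rows (proved-existing 29, proved 15,
typed-existing 5, typed 5); KEY stmt-QuantumFields-20542, also-feeds 20544».  RULES (`carve/CARVE-RULES.md` §2): IN TREE =
CITE, NEVER RESTATE; residual printed statements in hypothesis form `def …Printed : Prop`; ONE bundle `Hyp`; no
`instance`, no `notation`, 0 `sorry`.  Off-limits stems (BLOCKS-41-48 note (iv)): `B5G0*` ∕ `B5Prop12*` — not touched,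
not needed (pp. 36–40).

## WHAT THE BLOCK'S PAGES PRINT AND WHERE THE TREE HOLDS IT (cite table — all 54 SKELETON rows of the block and all 9
## statement-level declarations in range are IN TREE and cited here BY NAME; nothing below is restated)
* p. 17–18, Sect. A set-up: the torus T_ε, bonds, (1.1) «A_{⟨x,x+εe_μ⟩} = A(x, x + εe_μ) = A_μ(x)» — `B5Prop11Plancherel.Tor`,
  `B5SectBStatements.Fld` (rows B5.Eq1.1, B5.Eq1.1-6: `Setup`'s `PBond`); plaquettes and (1.2) «F(p) = (∂A)(p) =
  ε⁻¹A(∂p) = … = F_{μν}(x)» — `B5Action121.Fs` (row B5.Eq1.2; V1 twin `LatticeFieldCalculus.curlAction`, row B5.Eq1.3-1.8);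
  (1.3) «S^ε(A) = ½Σ_p ε^d|F(p)|² = … = ¼Σ_{x,μ,ν} ε^d|F_{μν}(x)|²» — `B5Action121.actionS_eq_quarter` (row B5.Eq1.3); (1.4)
  «A^λ_b = A_b − (∂λ)(b), (∂λ)(b) = ε⁻¹(λ(b₊) − λ(b₋))» and «The covariant derivative ∂A, and so the action above, are
  invariant» — `B5Action121.GradOp`, `B5Action121.Fs_gaugeT` (row B5.Eq1.4; V1 `LatticeFieldCalculus.grad`,
  `LatticeFieldCalculus.gaugeShift`, `LatticeFieldCalculus.diverg`, rows B5.Eq1.4-1.4, B5.Eq1.4-1.9, B5.Eq1.21-1.5); the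
  rescaling «A_μ(εx) = ε^{−(d−2)/2}A_μ(x)» and (1.5) «S(A) = ½Σ_{p⊂T₁}|F(p)|²» — `B5SectAStatements.action15`, `rescale15`,
  PROVED `B5SectAStatements.eq15` (row B5.Eq1.5); (1.6) blocks B(y) — `B5Block118.bpt` (row B5.Eq1.6); (1.7) contours
  Γ_{y,x} — `B6BondElimination.contour`, `B5SectBStatements.axSum` (row B5.Eq1.7).
* p. 19: (1.8) the three-contour average B_c — `B6Lemma24PrintedShape.q18` (row B5.Eq1.8); (1.9) «B^λ_c = B_c − (∂λ)(c)» —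
  `Beta.AveragingContours.linAvg_gauge` (row B5.Eq1.9; V1 `LatticeFieldCalculus.bondAvg_gaugeShift`, row B5.Eq1.9-1.20);
  «we restrict the gauge transformations by the condition λ(y) = 0 … Axial (Ax) gauge fixing conditions A(Γ_{y,x}) = 0»
  and (1.10) δ_Ax — `B5SectBStatements.Ax` (row B5.Eq1.10; `AveragingRT.axialAvg`, row B5.Eq0.3); (1.11) Q and δ(B − QA)
  — `B5SectBStatements.qFun`/`Qlin` (row B5.Eq1.11; V1 `LatticeFieldCalculus.bondAvg`, row B5.Eq1.11-1.18); (1.12) «the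
  renormalization transformation T» — `B5Eq112RenormTransf.renormTransf` (row B5.Eq1.12, declaration of record, V1) and
  its torus twin `B5SectBStatements.rtT`/`rt12` (non-vacuity `B5SectBStatements.fibre_rt_nonempty`, `rtT_eq`); (1.13)
  «B^λ_c = B_c − (∂Q′λ)(c)» and «Fixing it we restrict the gauge transformations by the condition (Q′λ)(y) = 0» —
  `B5Block118.QvOp_gaugeT` (row B5.Eq1.13); the claim «We will prove later that the quadratic form ⟨∂A, ∂A⟩ is positive on
  the subspace of A satisfying QA = 0, A(Γ_{y,x}) = 0» — `B5SectAStatements.ClaimP19`, PROVED `claimP19_holds` (d ≥ 2;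
  part II Lemma 2.4), `claimP19_quantitative`, `claimP19_nonvacuous` (row B5.Claim@19).  Bundle member `Hyp.p19`.
  (1.14) «A result of the integration is obviously a Gaussian density» — `B5SectBStatements.Eq114` (row B5.Eq1.14), PROVED
  `B5Eq114Gauss.eq114_holds` (explicit `Z^{(0)}`, `Δ₁`: `B5Eq114Gauss.rt12_gauss`, `Z0_pos`).  Bundle member `Hyp.e114`.
  (1.15) «The form ⟨B, Δ₁B⟩ is gauge invariant … λ(x) = λ₁(y) for x∈B(y)» — PROVED `B5SectAStatements.eq115_formDk`,
  `eq115_d1Sq` (row B5.Eq1.15).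
* p. 20: «The density (1.14) is defined on the L-lattice T_L^{(1)} and our final operation is the rescaling from this
  lattice to the unit lattice T₁^{(1)}. The operation of rescaling is denoted by S.» — `B5SectBStatements.scaleDens` (row
  B5.Note@20: the field-rescaling factor = the parameter `c`/`w` of `LatticeFieldCalculus`, homonym row of
  `B3Eq123Counterterms.SEData.c`); Sect. B (1.16) «A composition of two transformations is easy to calculate … Q₂ is defined
  as Q only with the number L replaced by L² in all definitions» and (1.17) «It is easily seen that a composition of k
  transformations is given by …» — `B5SectBStatements.iterST`, `Eq116`, `Eq117`, `Qk`, `AxAll`, `rt17` (row B5.Eq1.17),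
  PROVED `B5Eq114Gauss.eq116_holds`, `eq117_holds` (every `k`, d ≥ 2; `eq117_one` any d); the tower `B5.Setting` /
  `B5SectBStatements.towerM` (rows B5.Eq1.16-1.19, B5.Eq1.12-1.14).  Bundle members `Hyp.e116`, `Hyp.e117`.  (1.18) Q_k —
  `B5Block118.QvOp` (row B5.Eq1.18); (1.19) «We define ((ST)^k e^{−S})(B) = Z_{k,Ax} exp(−½⟨B, Δ_kB⟩)» —
  `B5SectBStatements.Eq119` (row B5.Eq1.19), PROVED `B5Eq114Gauss.eq119_holds` (`Zk`, `DeltaK`, `rt17_gauss`).  Bundle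
  member `Hyp.e119`.  «It is easily seen that Z_{k,Ax} = Z^{(k−1)}·…·Z^{(0)}, where Z^{(j)} is a normalization factor
  connected with j + 1 integration» (`p0004:L22`) — in tree, PROVED: `B5Eq119ZProduct.iterST_exp_eq_Zprod` («((ST)^k e^{−S})(B)
  = Zprod·γ₁(W_iter B)»), `Zprod_eq_prod` / `Zfactors` / `length_Zfactors` (Z_{k,Ax} as the k-fold product of the one-step
  factors `stepZ` = Z^{(j)}), `rtT_gaussW` / `scaleDens_rtT_gaussW` / `iterST_gaussW` / `iterST_succ_gauss` («We can apply
  the renormalization transformation again to (1.14)»), `iterST_exp_eq_prod_DeltaK`, `eq119_prod` (d ≥ 2), `Zprod_curvLin_eq`,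
  `Zfactors_curvLin_pos` (the later docstrings of `B5SectBStatements.Eq119` / `B5Eq114Gauss` that still say «not separately
  typed» predate that module).
  (1.20) A^λ, (Q_kA^λ)_b, Q′_k and «Q_kA^λ = Q_kA − ∂Q′_kλ» — `B5Block118.QsOp`, `B5Block118.QvOp_gaugeT`,
  `B5SectBStatements.QsLin`/`Qsk` (row B5.Eq1.20); «The δ-function δ(B − Q_kA) is invariant with respect to gauge
  transformations λ satisfying Q′_kλ = 0 and we can look at the integral (1.17) as obtained by removing this gauge freedom
  by the help of the δ-functions δ_Ax» (`p0004:L29–L31`) — `B5Eq112TorusCarriers.Otor_le_ker`,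
  `B5Eq115GaugeChain.Qlin_sub_gradR_of_QsLin_eq_zero`, and the hierarchical-gauge lemma `B5.HierGauge.complete` /
  `B5.HierGauge.unique`, `B5Eq114Gauss.tower_pos` (cell GAPS G-B5-01R).
* p. 21, Sect. C: (1.21) «⟨∂A, ∂A⟩ = … = Σ_μ⟨A_μ, ΔA_μ⟩ − ⟨∂*A, ∂*A⟩» — PROVED `B5Action121.action_identity_121` (row
  B5.Eq1.21; V1 `LatticeFieldCalculus.divergenceForm`, row B5.Eq1.21-1.24; `B5SectBStatements.divSq`); (1.22) the
  Faddeev–Popov identity and «we will see that it is different from 0» — `B5SectBStatements.fp22`, `Claim122` (row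
  B5.Eq1.23 with (1.22); statement decl `B5SectBStatements.Claim122`), PROVED `B5Eq123Torus.claim122` (`fp22_pos`, every
  `k`, every `α > 0`).  Bundle member `Hyp.c122`.  «The restrictions on the gauge transformations given by the δ-functions
  above are chosen in such a way that all the expressions in the integral (1.17) with the exception of gauge fixing terms
  δ_Ax are invariant» (`p0005:L12–L14`) — `B5HierGaugeTorus.actionEta_gaugeR`, `B5Eq147Landau.exp_neg_actionEta_orbit`,
  `B5Eq112TorusCarriers.Otor_le_ker`.  (1.23) «We change the order of integrations … We get (1.17) = … (1.23)» —
  `B5SectBStatements.rt23`, `Eq123`, `eq123_of_eq117` (row B5.Eq1.23), PROVED `B5Eq123Torus.eq123_holds` (`rt17_eq_rt23`;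
  V1 twin `B5Eq123ChangeOfGaugeV1`).  Bundle member `Hyp.e123`.  (1.24) «∫dλδ(Q′_kλ)exp(−(1/2α)⟨∂*A^λ, ∂*A^λ⟩) = …
  exp(−(1/α) inf_{λ:Q′_kλ=0} ½‖∂*A − ∂*∂λ‖²), and the infimum can be calculated using Lagrange multipliers» —
  `B5GaussSectC.gaussW`, `integral_124`, `iInf_124` (row B5.Eq1.24; `B5Eq123Torus.fp22_eq_124`).
* p. 22: «g(λ, ω) = ½‖∂*A − Δλ‖² + ⟨ω, Q′_kλ⟩» and (1.25) — `B5Substitution125.Mop`, `B5Substitution125.lambda_eq`,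
  `omega_orth`, `omega_eq`, `lambda0_eq` (row B5.Eq1.25); «Now we use spectral properties of the Laplace operator Δ on the
  torus T_η. It is a symmetric, non-negative operator, and 0 is its eigenvalue. Constant functions form the eigenspace
  corresponding to the eigenvalue 0, and on the subspace orthogonal to constant functions the operator Δ is positive.
  Hence it is an invertible operator and by Δ⁻¹ we denote its inverse on this subspace. We extend it to the whole space by
  linearity, putting its value on constant functions equal to 0.» — PROVED `B5LaplaceSpectral.LapS_isHermitian`,
  `form_LapS_nonneg`, `LapS_const`, `LapS_ker_const`, `LapS_pos` (row B5.Def§C@22), `B5LaplaceInverse.LapSinv`; «the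
  operator Q′_k transforms constant functions on the η-lattice into constant functions on the unit lattice, and similarly
  for the orthogonal subspaces. This implies the corresponding property for Q′_k*» — PROVED `B5Substitution125.QsOp_const`,
  `QsOp_orth`, `QsOp_adjoint_const`, `QsOp_adjoint_orth`; «Q′_kΔ⁻²Q′_k* is positive also on the corresponding subspace on
  the unit lattice» — PROVED `B5Substitution125.Mop_pos`; «λ₀ = Δ⁻¹∂*A − Δ⁻²Q′_k*(Q′_kΔ⁻²Q′_k*)⁻¹Q′_kΔ⁻¹∂*A» and (1.26)
  «The value of the infimum is equal to …» — `B5Value126.lambda0`, PROVED `B5Value126.value_126a`, `value_126b` (row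
  B5.Eq1.26); (1.27), «It is easy to verify that the operator I − Δ⁻¹Q′_k*(Q′_kΔ⁻²Q′_k*)⁻¹Q′_kΔ⁻¹ is a projection in the
  space L²(T_η)», (1.28) — PROVED `B5Projection127.Pc_mul_Pc`, `form_Pc`, `B5Value126.PcT_mul_PcT`, `one_sub_PcT_proj`,
  `B5GaussSectC.calG_eq_127` (row B5.Eq1.28).
* p. 23: (1.29) the Fourier transform on T′_η and the dual torus — `B5Eq129FourierPrinted.ft` (row B5.Eq1.29); (1.30)–(1.31)
  the equations in momentum representation, Δ(p), ∂_μ(p), u_k(p), the dual tori and «p = p′ + l, l_μ = 2πm_μ, …» —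
  `B5Block118.dft_QsOp`, `B5Momentum130.eq130_iff`, `B5Prop11Fiber.dSym`/`d1Sym`/`uSym` (row B5.Eq1.31); «The first
  equation in (1.30) can be solved uniquely for p ≠ 0 and we get (1.32), for p = 0 the equation implies ω̃(0) = 0.  The
  second equation gives (1.33)», «Because u_k(l) = 0 for l ≠ 0, u_k(0) = 1, so this equation implies also λ̃(0) = 0»,
  (1.34) — PROVED `B5Momentum130.eq132`, `omega_hat_zero`, `lambda0_hat_zero`, `lambda0_hat_l`, `B5FiberZero.uSym_zero`
  (row B5.Eq1.34).
* p. 24: (1.35) and «We have used also the equality (∂*A)~(p) = Σ_μ \overline{∂_μ(p)}Ã_μ(p), more exactly its consequence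
  (∂*A)~(0) = 0» — PROVED `B5Eq135Momentum.eq135`, `eq135_mid`, `sum_norm_sq_dft` (row B5.Eq1.36 = «(1.35)–(1.37)»);
  «From (1.30) we have Δ(p) = O(|p|²) … the quotient Δ₀(p)/Δ(p) is bounded, more exactly we have Δ₀(p′)/Δ(p′+l) ≦
  O(1)1/(1 + |l|²)» (`p0008:L12–L17`) — RESIDUAL, §2 `Quotient24Printed`, PROVED §2b (tree: `Δ₀(p′) ≦ Δ(p′+l)`,
  `B5Prop11Leaves.Delta1r_le_DeltaXir_shift`, and Jordan on the zone `B5G183Rate.Sxir_ge_jordan`; the decay in `l` is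
  nowhere).  Bundle member `Hyp.q24`.  (1.36) «|u_k(p′+l)| ≦ O(1)Π|p′_μ|/|p′_μ+l_μ| ≦
  O(1)Π 1/(1+|l_μ|)» (`p0008:L18–L19`) — the display itself has no declaration under a [B5] locator (row B5.Eq1.36's
  decls are (1.35)/(1.37); tree: `B5Prop11Leaves.Ur_le_one`, `sum_Ur_eq_one`, `B5Prop11Fiber.norm_uSym_le_one`, and the
  middle-member majorant in KING's form `B5Hk163Rate.norm_uWeight_le_vMaj` [King1986 (4.20)] on `King1986.uWeight`; the
  decay member is nowhere) — RESIDUAL, §2 `Ineq136Printed` (both inequalities, the paper's `u_k` and windows), PROVED §2b.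
  Bundle member `Hyp.i136`.  (1.37) and «Now all the expressions above are well defined and bounded even at p′ = 0 if we
  extend them by continuity. The expression in |…|² defines the projection operator acting on ∂*A and appearing in
  (1.27)» — PROVED `B5Eq135Momentum.eq137`, `dft_PcT_eq_bracket137`; (1.38) R — `B5Projector144.R138`, `P138` (row
  B5.Eq1.38); (1.39) 𝒢_α — `B5GaussSectC.calG` (row B5.Eq1.41 with (1.39)–(1.41)).
* p. 25: «from its definition it follows that ∫dλδ(Q′_kλ)𝒢_α(∂*A^λ) = 1» (`p0009:L2`) — PROVED
  `B5GaussSectC.integral_calG_sub_Delta_torus` (row B5.Eq1.41); «The projection operator R has a clear meaning. It is an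
  orthogonal projection on the linear subspace ΔN(Q′_k) of L²(T_η) … Indeed RΔλ = Δλ if Q′_kλ = 0, and if Rω = ω then
  Δ₀Q′_kΔ⁻¹ω = 0, and taking λ = Δ⁻¹ω we have ω = Δλ and Q′_kλ = 0» — `B5GaussSectC.Rop` (orthogonal projection onto
  `Rsub = Δ(N)`), PROVED `B5Projector144.R138_lap`, `R138_fix_iff`, `R138_fix_iff_unitLap`, `R138_idem`/`R138_symm`, with
  the audit's caveat `B5Projector144.printed_clause_fails` (the literal clause on ALL scalar functions vs. on divergences;
  cf. `B5Lagrange149Torus` DIVERGENCE (i)); (1.40) — `B5GaussSectC.ZN_eq`, `integral_Rsub_eq`; (1.41) «so the density 𝒢_α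
  has a limit as α → 0» — PROVED `B5GaussSectC.tendsto_integral_calG` (row B5.Eq1.41); «recall also that the operator Δ is
  positive definite on N(Q′_k), thus invertible, as it follows from [2]» (`p0009:L17`) — PROVED `B5GaussSectC.injOn_torus`,
  `B5Projector144Exists.lapK_injective` ([2] = `B4.ThmPrinted`/`B4.Lemma24Printed`); (1.42) «with a > 0 (we will take
  eventually a = 1), … Δ′_a = Δ + aQ′_k*Q′_k = Δ + aP′_k. The properties of this operator were investigated in [2], its
  inverse is a bounded operator G′_k with good regularity properties described in Theorem of [2]» (`p0009:L21–L24`) —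
  `B5Projector144.lapPrime`, `B5Projector144Exists.green`, PROVED `B5Projector144.norm_sq_split_142`, `inf_142` ([2] Theorem
  = `B4.ThmPrinted`, block 41's pages); (1.43) λ₀ and (1.44) R — `B5Projector144.lambda0`, `residual_143`, `R144` (row
  B5.Eq1.44), `norm_sq_eq`; «Now all the operators appearing in these formulas are well defined. … It is enough to prove that
  Q′_kG′_k²Q′_k* is positive definite. This operator is of course nonnegative and if … ⟨ω, Q′_kG′_k²Q′_k*ω⟩ = ‖G′_kQ′_k*ω‖² = 0,
  then Q′_k*ω = 0, hence ω = 0» (`p0009:L29–L32`) — PROVED `B5Projector144Exists.inner_qggq`, `qggq_nonneg`,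
  `qs_eq_zero_of_green`, `qggq_injective`, `qggq_pos`, `exists_greenData`, `exists_all_printed` (row B5.Claim@25),
  `B5Substitution125.QsOp_adjoint_injective`; «We have bounds 0 < Q′_kG′_k²Q′_k* ≦ a⁻², and they imply the existence of the
  inverse operator and a bound from below» (`p0009:L33–L34`) — `B5.Bounds145Printed` (with the p. 26 sentence), PROVED for
  `0 < a ≦ 1` `B5QGGQ145Gamma1.printed_bounds_small_a`, `printed_inverse_bounds_small_a`, `ev_le_inv_sq`; «It is a translation
  invariant operator on the unit lattice T₁^{(k)} and its Fourier transform can be written using formula (2.48) from [2]»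
  and (1.45) — `B5QGGQ145Torus.qggq`, `B5Strip145.mReg`/`Ncalr`, `B5QGGQ145Bounds.ev`, `mReg_dual_eq_ev` (row B5.Eq1.45).
* p. 26: «From this representation and from the bounds (2.51), (2.52) of that paper, it follows that there are positive
  constants γ₀, γ₁, in fact γ₀ dependent only on d, γ₁ = a⁻², such that γ₀ ≦ Q′_kG′_k²Q′_k* ≦ γ₁» (`p0010:L3–L5`) —
  `B5.Bounds145Printed` (row B5.Eq1.45; statement decl), AS PRINTED: TRUE for `0 < a ≦ 1`
  (`B5Gamma1FailsLargeA.bounds145Printed_small_a`, `B5QGGQ145Gamma1.gamma0_le_ev`), FALSE for large `a`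
  (`B5Gamma1FailsLargeA.not_bounds145Printed_all_a`, `B5.printed_gamma1_fails`; repaired provable form `B5.Bounds145`,
  `B5.bound145_scalar`, `B5.bounds145_of_printed`; cell GAPS G-B5-13).  Bundle member `Hyp.b145`.  «The operator R given by
  (1.44) is of course by definition independent of a and we can take arbitrary a in the representation, e.g. a = 1»
  (`p0010:L7–L9`) — PROVED `B5Projector144.R144_indep`.  Sect. D: «In the sequel it will be convenient to take the limit
  α → 0, i.e. to consider Landau gauge. We may introduce this gauge from the beginning using the equation (1.46)» —
  PROVED `B5GaussSectC.integral_146`, `integral_146_torus` (row B5.Eq1.47 with (1.46)); (1.47) — `B5Eq147Landau.Eq147`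
  (statement decl), `rt47`, PROVED `B5Eq147Landau.eq147_holds` (`rt17_eq_const_mul_rt47`, `rt47_gauss`; also
  `B5Eq147FromEq123.eq147_of_eq123` along the printed route).  Bundle member `Hyp.e147`.  «With this integral an operator of
  fundamental importance is connected. It is defined on configurations B on the lattice T₁^{(k)} and its value on such a
  configuration is equal to a configuration A on T_η minimizing the form ½⟨∂A, ∂A⟩ under the conditions Q_kA = B, R∂*A =
  0.» — `B5.HkData`/`B5.HkPropsPrinted` (p. 29, block 44) and PROVED on the torus `B5Lagrange149Torus.cEnergy_le_of_el149`,
  `exists_el149_iff_isConstrainedMin`, `B5Hk160Torus.H160`; (1.48) h(A, ω, λ), (1.49), «We have R∂*A = ∂*A − … = 0, so the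
  first equation has the form (1.50)» — PROVED `B5Lagrange149Torus.hLag`, `e148a`, `e148b`, `EL149`,
  `el149_iff_stationary`, `e150` (rows B5.Eq1.49, B5.Eq1.55; `LatticeFieldCalculus.landauFunctional`, row B5.Eq2.8-1.27).
* p. 27: «It implies that ω is orthogonal to constant functions», (1.51), «Let us notice that A′ is orthogonal to constant
  functions also», (1.52), «A solvability condition for this equation is (1.53)», (1.54), «where λ′ = Q′_kΔ^{−3/2}∂*A′. The
  configuration A can be expressed in terms of A′ as follows: A = Δ^{−1/2}A′ + A₀, where A₀ is a constant configuration»,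
  (1.55) «Q_k∂ = ∂₁Q′_k, ∂₁ is the unit lattice differentiation», (1.56), «so for λ = 0 the third equation in (1.49) is
  satisfied automatically», (1.57), «It implies that B − Q_kA₀ is orthogonal to constant functions … we can identify Q_kA₀ =
  B₀, or A₀ = Q_k*B₀. Further we have the solvability condition (1.53) … which is equivalent to ∂₁*ω = 0», (1.58) «φ =
  Q_kΔ⁻¹Q_k*», «Equation (1.57) can be solved with respect to ω and we get ω = + φ⁻¹∂₁λ′ − φ⁻¹B′. The solvability condition
  gives the equation ∂₁*ω = ∂₁*φ⁻¹∂₁λ′ − ∂₁*φ⁻¹B′ = 0. This equation can be solved with respect to λ′, and we get λ′ =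
  (∂₁*φ⁻¹∂₁)⁻¹∂₁*φ⁻¹B′.» (`p0011:L2–L34`) — ALL PROVED on the double torus: `B5Lagrange149Torus.orthConst_omega`, `e151`,
  `orthConst_Ap`, `e152`, `e153a`, `e153`, `e154`, `A_decomp`, `B5Hk160Torus.QvOp_GradOp_mulVec` ((1.55)), `e156a`,
  `e156b`, `lam_const`, `e157`, `orthConst_B_sub`, `QvOp_A0`, `A0_eq`, `e153_iff`, `B5Phi162Torus.PhiOp`/`PhiInv` ((1.58),
  row B5.Eq1.58), `omega_eq`, `e153_solved`, `lamp_eq_Lam` (rows B5.Eq1.55 «(1.50)–(1.57)», B5.Eq1.58; the file's own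
  census: «Nothing on pp. 26–28 between «Let us calculate this minimum» and (1.59) is left uncertified»).
* V1-calculus rows of the range (typed on `LatticeFieldCalculus`, cited for completeness): B5.Eq14 `LatticeFieldCalculus.runSite`,
  B5.Eq1.3-1.8 `curlAction`, B5.Eq1.4-1.4 `grad`, B5.Eq1.4-1.9 `gaugeShift`, B5.Eq1.21-1.5 `diverg`, B5.Eq1.11-1.18 `bondAvg`,
  B5.Eq1.9-1.20 `bondAvg_gaugeShift`, B5.Eq1.21-1.24 `divergenceForm`, B5.Eq2.8-1.27 `landauFunctional`, B5.Eq0.3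
  `AveragingRT.axialAvg`, B5.Eq1.16-1.19 / B5.Eq1.12-1.14 `B5.Setting`.

## WHAT THIS FILE ADDS
§1 — withdrawn in v1.1 (v1 re-typed here, as `ZProduct119Printed` + `Hyp.z119`, the p. 20 product sentence which the tree
already PROVES in `B5Eq119ZProduct`, see the p. 20 line of the table; M-c3-2, repair (A): cited, dropped, no row offered).
§2 THE TWO RESIDUAL PRINTED BOUNDS of p. 24 with no declaration of record (searched 2026-08-28: HOME `EXISTING-DECLS.tsv`, all
rows `Balaban1984PropagatorsI` with locator p. 24 or (1.36) — none; `rg` over `Balaban1983to89/B5*.lean`, `B4Strip*.lean`,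
`B5Prop11*.lean`, `King1986*.lean` for the decay in `l` — none; nearest in tree: King's (4.20) majorant
`B5Hk163Rate.norm_uWeight_le_vMaj` = the middle member of (1.36) on King's `uWeight`, and the gate's dedup twin of the
numerator step `B5G183Rate.norm_d1Sym_le` (used inline, not imported: it would pull the NE-spine rate modules into this
file's closure); the tree's (1.45)/(1.35)/(1.37) certificates use `Σ_l|u|² = 1` and `Δ₀ ≦ Δ` instead of any decay): `Quotient24Printed` («Δ₀(p′)/Δ(p′+l) ≦ O(1)1/(1+|l|²)») and `Ineq136Printed` ((1.36)), hypothesis form over the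
tree's concrete symbols (`B4Strip.Delta1r`/`DeltaXir`/`shiftr`, `B5Prop11Fiber.uSym`) with the print's symmetric
representatives `l_μ = 2πm_μ` made explicit (`mRep`, `lRep`, windows `two_mul_abs_mRep_le`, `two_mul_mRep_lt`,
`mRep_modEq`) and the removable 0/0 of the middle member of (1.36) filled as print says (`ratio136`) — AND PROVED (§2b:
`quotient24Printed_holds` with `C = 18π⁴d + 4π²d + 1`, `ineq136Printed_holds` with `C₁ = (3π/2)^d`, `C₂ = (4π)^d`, from
the private helper `abs_sin_ge` («`|sin x| ≧ (2/(3π))|x|` on `|x| ≦ 3π/4`»), `norm_dSym_eq_sin`, `dSym_lower`,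
`norm_vSym_le_ratio`, `ratio136_le`, `DeltaXir_shift_ge`).
§3 THE BUNDLE `Hyp L M proj` — the printed CLAIMS of pp. 17–27 AS HYPOTHESES, BY NAME, in page order (p. 19 claim, (1.14),
(1.16), (1.17), (1.19), (1.22), (1.23), p. 24 quotient bound, (1.36), p. 25/26 bounds, (1.47); 11 members); consumer forms:
`hyp_of` (d ≥ 2: EVERY member except `b145` is a THEOREM — of the tree, or of §2b — so the printed (1.45) bounds are the
ONE remaining input), `hyp_torusForm` (d ≥ 2: the whole bundle HOLDS at the tree's (1.45) torus family
for `0 < a ≦ 1` — the paper's «we will take eventually a = 1»), `not_hyp_torusForm_all_a` (read for all `a > 0` the printed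
«γ₁ = a⁻²» makes the bundle FALSE — G-B5-13), `Hyp.bounds145` (the repaired (1.45) bounds).

## HONEST SCOPE
Nothing of [B5] is proved here beyond §2b's elementary trigonometry on the symbols of (1.31); the p. 19 claim,
(1.14)–(1.23), the p. 20 product sentence, (1.47) are NOT re-proved here (hypothesis slots by name / citations — their
PROOFS are the tree's `B5SectAStatements.claimP19_holds`, `B5Eq114Gauss.*`, `B5Eq119ZProduct.*`, `B5Eq123Torus.*`,
`B5Eq147Landau.eq147_holds`, cited above, all for `2 ≤ d`, every `L ≥ 1`, every torus, U = 1); `B5.Bounds145Printed` enters AS PRINTED (true at the paper's own `a = 1`,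
false for large `a`).  The DAG leaf of [B5] (`B5.MainBlock` = Props. 1.1–1.2 + (1.67)) lives on
pp. 28–40 (block 44) and is not touched.  Readings (none is an objection to print): (a) «O(1)» in §2 = a constant chosen
before `k`, the torus and the momentum (d fixed); (b) offsets `l` through the tree's classes `Fin n` with the printed
symmetric representative.  No
summit statement is proved by this seat; count-neutral; nothing continuum ∕ ℝ⁴ ∕ OS ∕ mass-gap ∕ Clay.  No `sorry`, no
`instance`, no `notation`.
-/

open scoped BigOperators
open Finset

namespace Literature.MathematicalPhysics.QuantumFieldTheory.Balaban1983to89.B5Carve43SectsADHyp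

open B5Prop11Plancherel (Tor fine)
open B5SectBStatements (Fld Eq114 Eq116 Eq117 Eq119 Claim122 Eq123)

noncomputable section

/-! ## §1  (withdrawn in v1.1 — M-c3-2: the p. 20 product sentence «Z_{k,Ax} = Z^{(k−1)}·…·Z^{(0)}» is DECLARED AND
PROVED in the tree module `B5Eq119ZProduct` (`stepZ`, `rtT_gaussW`, `scaleDens_rtT_gaussW`, `Zprod`, `Zfactors`, `Zprod_eq_prod`,
`iterST_gaussW`, `iterST_exp_eq_Zprod`, `iterST_succ_gauss`, `iterST_exp_eq_prod_DeltaK`, `eq119_prod`; linearity helpers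
`rtT_const_mul`, `scaleDens_const_mul`, `iterST_const_mul`) — CITED, nothing re-typed here) -/
/-! ## §2  p. 24: the two symbol bounds of the text — (1.36) and the quotient sentence before it (hypothesis form) -/

section SymbolBounds

variable {d : ℕ}

/-- The symmetric representative `m` of an offset class (p. 23 [PDF 7], after (1.31), verbatim: «l = (l₁, …, l_d),
l_μ = 2πm_μ, m_μ is an integer, −(L^k − 1)/2 ≦ m_μ ≦ (L^k − 1)/2 for L odd, −L^k/2 ≦ m_μ < L^k/2 for L even»): with
`n = L^k` and the class represented by `j ∈ {0, …, n − 1}` (the tree's `k : Fin d → Fin n` of `B4Strip.shiftr` /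
`B5Prop11Fiber.uSym`), `m = j` if `2j < n` and `m = j − n` otherwise — both printed windows at once (`two_mul_abs_mRep_le`).
[cite: Balaban1984PropagatorsI, (1.31) p.23] -/
def mRep (n : ℕ) (j : Fin n) : ℤ := if 2 * (j : ℕ) < n then ((j : ℕ) : ℤ) else ((j : ℕ) : ℤ) - n

/-- `l_μ = 2πm_μ` for the symmetric representative. [cite: Balaban1984PropagatorsI, (1.31) p.23] -/
def lRep (n : ℕ) (j : Fin n) : ℝ := 2 * Real.pi * (mRep n j : ℝ)

/-- `m ≡ j (mod n)`: the symmetric representative represents the same class. [cite: Balaban1984PropagatorsI, (1.31) p.23] -/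
theorem mRep_modEq (n : ℕ) (j : Fin n) : mRep n j ≡ ((j : ℕ) : ℤ) [ZMOD n] := by
  unfold mRep
  split_ifs
  · rfl
  · exact Int.modEq_iff_dvd.mpr ⟨1, by ring⟩

/-- The printed windows in one inequality: `2|m_μ| ≤ n` (odd `n`: `|m| ≤ (n − 1)/2`; even `n`: `−n/2 ≤ m < n/2`).
[cite: Balaban1984PropagatorsI, (1.31) p.23] -/
theorem two_mul_abs_mRep_le (n : ℕ) (j : Fin n) : 2 * |mRep n j| ≤ n := by
  unfold mRep
  have hj := j.is_lt
  split_ifs with h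
  · rw [abs_of_nonneg (by positivity)]
    exact_mod_cast h.le
  · rw [abs_of_nonpos (by omega)]
    omega

/-- The printed even-`n` window is half-open: `m < n/2`, i.e. `2m < n`. [cite: Balaban1984PropagatorsI, (1.31) p.23] -/
theorem two_mul_mRep_lt (n : ℕ) (j : Fin n) : 2 * mRep n j < n := by
  unfold mRep
  have hj := j.is_lt
  split_ifs with h
  · exact_mod_cast h
  · omega

/-- One factor `|p′_μ|/|p′_μ + l_μ|` of the middle member of (1.36), with the removable `0/0` (which occurs exactly at
`p′_μ = l_μ = 0`) filled by its limit `1` — the same convention the tree uses for the factor `∂¹_μ(p′)/∂_μ(p′+l)` of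
`u_k` (`B5Prop11Fiber.vSym`: value `1` where `∂_μ(p′+l) = 0`) and print's own «extend them by continuity» (p. 24).
[cite: Balaban1984PropagatorsI, (1.36) p.24] -/
def ratio136 (s l : ℝ) : ℝ := if s + l = 0 then 1 else |s| / |s + l|

/-- `ratio136` is nonnegative. [cite: Balaban1984PropagatorsI, (1.36) p.24] -/
theorem ratio136_nonneg (s l : ℝ) : 0 ≤ ratio136 s l := by
  unfold ratio136
  split_ifs
  · exact zero_le_one
  · positivity

/-- **(1.36)** p. 24 [PDF 8] (`p0008:L18–L19`), verbatim: «Similarly we have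
|u_k(p′ + l)| ≦ O(1) Π_{μ=1}^{d} |p′_μ|/|p′_μ + l_μ| ≦ O(1) Π_{μ=1}^{d} 1/(1 + |l_μ|).   (1.36)» — for the symbol
`u_k(p′+l) = Π_μ (e^{ip′_μ} − 1)/((e^{iη(p′_μ+l_μ)} − 1)/η)` of (1.31) (the tree's `B5Prop11Fiber.uSym n k s`, `η = 1/n`,
`n = L^k`, `s = p′ ∈ [−π, π]^d`, offsets `k : Fin d → Fin n` with `l_μ = 2πm_μ`, `m_μ` the symmetric representative
`mRep`).  Hypothesis form: the two «O(1)» are constants `C₁, C₂` chosen before `k` (i.e. `n`), the torus and the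
momentum; the second printed inequality is typed for the bare products (its O(1) absorbs the first).  No declaration of
record before under a [B5] locator (SKELETON row B5.Eq1.36 «(1.35)–(1.37)» is carried by `B5Eq135Momentum.eq135`/
`eq137`, which do not state (1.36); the tree has `|u_k| ≦ 1` and `Σ_l |u_k(p′+l)|² = 1`, `B5Prop11Leaves.Ur_le_one`/
`sum_Ur_eq_one`, and — under KING's name, [King1986] (4.20), on King's objects `King1986.uWeight`/`uFac` at zone
representatives `|q_ν| ≦ πn` — the MIDDLE-member majorant `B5Hk163Rate.vMaj`/`norm_uWeight_le_vMaj` (per-factor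
`(π/2)|p′_ν|/|q_ν|`); the last member, the decay `Π 1/(1+|l_μ|)`, is nowhere).
PROVED below with `C₁ = (3π/2)^d`, `C₂ = (4π)^d` (`ineq136Printed_holds`, §2b: `2|sin(x/2)| ≦ |x|` and
`|sin x| ≧ (2/(3π))|x|` on `|x| ≦ 3π/4`). [cite: Balaban1984PropagatorsI, (1.36) p.24] -/
def Ineq136Printed (d : ℕ) : Prop :=
  ∃ C₁ C₂ : ℝ, ∀ (n : ℕ) [NeZero n] (k : Fin d → Fin n) (s : Fin d → ℝ), (∀ μ, |s μ| ≤ Real.pi) →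
    ‖B5Prop11Fiber.uSym n k s‖ ≤ C₁ * ∏ μ, ratio136 (s μ) (lRep n (k μ)) ∧
      ∏ μ, ratio136 (s μ) (lRep n (k μ)) ≤ C₂ * ∏ μ, (1 + |lRep n (k μ)|)⁻¹

/-- **p. 24 [PDF 8]** (`p0008:L12–L17`), the sentence before (1.36), verbatim: «From (1.30) we have Δ(p) = O(|p|²) in a
neighbourhood of 0. Let us introduce the unit lattice operator Δ₀(p′) = Σ_{μ=1}^{d} |e^{ip′_μ} − 1|². It has the same
asymptotic behaviour Δ₀(p′) = O(|p′|²) in a neighbourhood of 0 as Δ(p), so the quotient Δ₀(p)/Δ(p) is bounded, more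
exactly we have Δ₀(p′)/Δ(p′ + l) ≦ O(1)1/(1 + |l|²).» — for the symbols `Δ₀(p′) = Σ_μ |e^{ip′_μ} − 1|²` (the tree's
`B4Strip.Delta1r 0 s`) and `Δ(p′+l) = Σ_μ |∂_μ(p′+l)|²` of (1.31) (`B4Strip.DeltaXir n 0 (B4Strip.shiftr n k s)`, `η = 1/n`),
`|l|² = Σ_μ l_μ²` with the symmetric representatives `l_μ = lRep n (k μ)`.  Hypothesis form: «O(1)» = a constant `C`
chosen before `n`, the torus and the momentum.  (At `p′ = 0`, `l = 0` the quotient is `0/0`, typed `0` by Lean's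
convention — harmless for an upper bound; print extends «by continuity».)  No declaration of record before (the tree has
`Δ₀(p′) ≦ Δ(p′+l)`, `B5Prop11Leaves.Delta1r_le_DeltaXir_shift`, not the decay in `l`).  PROVED below with
`C = 18π⁴d + 4π²d + 1` (`quotient24Printed_holds`, §2b). [cite: Balaban1984PropagatorsI, p.24 (sentence before (1.36))] -/
def Quotient24Printed (d : ℕ) : Prop :=
  ∃ C : ℝ, ∀ (n : ℕ) [NeZero n] (k : Fin d → Fin n) (s : Fin d → ℝ), (∀ μ, |s μ| ≤ Real.pi) →
    B4Strip.Delta1r 0 s / B4Strip.DeltaXir n 0 (B4Strip.shiftr n k s) ≤ C * (1 + ∑ μ, lRep n (k μ) ^ 2)⁻¹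

end SymbolBounds

/-! ### §2b  The two p. 24 bounds PROVED (elementary trigonometry on the symbols of (1.31)) -/

section SymbolBoundsProofs

variable {d : ℕ}

open B5Prop11Fiber (dSym d1Sym vSym uSym norm_dSym_sq norm_d1Sym_sq dSym_eq_zero_iff)
open B4Strip (S1r Sxir shiftr Delta1r DeltaXir)

/-- Jordan's inequality on the larger window: `(2/(3π))|x| ≤ |sin x|` for `|x| ≤ 3π/4` (private calculus helper for
`dSym_lower`; locator: Bałaban CMP 95 (1.36) p. 24, not a statement of the paper). [folklore] -/
private theorem abs_sin_ge (x : ℝ) (hx : |x| ≤ 3 * Real.pi / 4) : 2 / (3 * Real.pi) * |x| ≤ |Real.sin x| := by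
  have hπ := Real.pi_pos
  have key : ∀ t : ℝ, 0 ≤ t → t ≤ 3 * Real.pi / 4 → 2 / (3 * Real.pi) * t ≤ Real.sin t := by
    intro t ht0 ht1
    by_cases h : t ≤ Real.pi / 2
    · have h1 := Real.mul_le_sin ht0 h
      have h2 : 2 / (3 * Real.pi) * t ≤ 2 / Real.pi * t := by
        apply mul_le_mul_of_nonneg_right _ ht0
        rw [div_le_div_iff₀ (by positivity) hπ]
        nlinarith
      linarith
    · have h := not_le.mp h
      have h3 : Real.sin t = Real.sin (Real.pi - t) := (Real.sin_pi_sub t).symm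
      have h4 : 0 ≤ Real.pi - t := by linarith
      have h5 : Real.pi - t ≤ Real.pi / 2 := by linarith
      have h6 := Real.mul_le_sin h4 h5
      have h7 : Real.pi / 4 ≤ Real.pi - t := by linarith
      have h8 : (1 : ℝ) / 2 ≤ 2 / Real.pi * (Real.pi - t) := by
        calc (1 : ℝ) / 2 = 2 / Real.pi * (Real.pi / 4) := by field_simp; ring
          _ ≤ 2 / Real.pi * (Real.pi - t) := mul_le_mul_of_nonneg_left h7 (by positivity)
      have h9 : 2 / (3 * Real.pi) * t ≤ 1 / 2 := by
        calc 2 / (3 * Real.pi) * t ≤ 2 / (3 * Real.pi) * (3 * Real.pi / 4) :=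
              mul_le_mul_of_nonneg_left ht1 (by positivity)
          _ = 1 / 2 := by field_simp; ring
      linarith
  have hk := key |x| (abs_nonneg x) hx
  have hs : Real.sin |x| ≤ |Real.sin x| := by
    rcases abs_choice x with h | h
    · rw [h]; exact le_abs_self _
    · rw [h, Real.sin_neg]; exact neg_le_abs _
  exact hk.trans hs

/-- `m = 0` exactly for the zero class. [cite: Balaban1984PropagatorsI, (1.31) p.23] -/
theorem mRep_eq_zero_iff (n : ℕ) [NeZero n] (j : Fin n) : mRep n j = 0 ↔ j = 0 := by
  constructor
  · intro h
    unfold mRep at h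
    have hj := j.is_lt
    split_ifs at h with h2
    · exact Fin.ext (by simpa using h)
    · omega
  · rintro rfl
    simp [mRep, Nat.pos_of_ne_zero (NeZero.ne n)]

/-- A printed `l_μ = 2πm_μ` cancelling a momentum `|p′_μ| ≦ π` forces `m_μ = 0` and `p′_μ = 0`. [cite: Balaban1984PropagatorsI, (1.31) p.23] -/
theorem lRep_eq_zero_of_add_eq_zero {n : ℕ} {j : Fin n} {s : ℝ} (hs : |s| ≤ Real.pi) (h : s + lRep n j = 0) :
    lRep n j = 0 ∧ s = 0 := by
  have hπ := Real.pi_pos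
  have hm : |(mRep n j : ℝ)| ≤ 1 / 2 := by
    have h1 : |lRep n j| ≤ Real.pi := by
      rw [show lRep n j = -s by linarith, abs_neg]; exact hs
    unfold lRep at h1
    rw [abs_mul, abs_of_pos (by positivity : (0 : ℝ) < 2 * Real.pi)] at h1
    by_contra hc
    have hc := not_le.mp hc
    nlinarith
  have hm0 : mRep n j = 0 := by
    have h2 : ((|mRep n j| : ℤ) : ℝ) < 1 := by rw [Int.cast_abs]; linarith
    exact Int.abs_lt_one_iff.mp (by exact_mod_cast h2)
  have hl : lRep n j = 0 := by unfold lRep; rw [hm0]; simp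
  exact ⟨hl, by rw [hl, add_zero] at h; exact h⟩

/-- `|∂_μ(p′ + l)| = 2n|sin((p′_μ + l_μ)/(2n))|` with the SYMMETRIC representative `l_μ = 2πm_μ` (the tree's `shiftr` uses
`2πj`, `j ∈ {0,…,n−1}`; the two arguments differ by `0` or `π` inside the sine). [cite: Balaban1984PropagatorsI, (1.31) p.23] -/
theorem norm_dSym_eq_sin (n : ℕ) [NeZero n] (k : Fin d → Fin n) (s : Fin d → ℝ) (μ : Fin d) :
    ‖dSym n k s μ‖ = 2 * n * |Real.sin ((s μ + lRep n (k μ)) / (2 * n))| := by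
  have hn : (0 : ℝ) < n := by exact_mod_cast Nat.pos_of_ne_zero (NeZero.ne n)
  have hcase : shiftr n k s μ / (2 * n) = (s μ + lRep n (k μ)) / (2 * n) ∨
      shiftr n k s μ / (2 * n) = (s μ + lRep n (k μ)) / (2 * n) + Real.pi := by
    unfold lRep mRep
    simp only [shiftr]
    split_ifs with h
    · left; push_cast; ring
    · right; push_cast; field_simp; ring
  have hsq : Real.sin (shiftr n k s μ / (2 * n)) ^ 2 = Real.sin ((s μ + lRep n (k μ)) / (2 * n)) ^ 2 := by
    rcases hcase with h | h
    · rw [h]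
    · rw [h, Real.sin_add_pi, neg_sq]
  have h1 : ‖dSym n k s μ‖ ^ 2 = (2 * n * |Real.sin ((s μ + lRep n (k μ)) / (2 * n))|) ^ 2 := by
    rw [norm_dSym_sq, B4Strip.Sxir_eq, mul_pow, sq_abs, hsq]; ring
  exact (pow_left_inj₀ (norm_nonneg _) (by positivity) two_ne_zero).mp h1

/-- Lower bound `(2/(3π))|p′_μ + l_μ| ≤ |∂_μ(p′ + l)|` (symmetric `l_μ`; the printed windows give
`|p′_μ + l_μ|/(2n) ≤ 3π/4`). [cite: Balaban1984PropagatorsI, (1.31) p.23, (1.36) p.24] -/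
theorem dSym_lower (n : ℕ) [NeZero n] (k : Fin d → Fin n) (s : Fin d → ℝ) (μ : Fin d) (hs : |s μ| ≤ Real.pi) :
    2 / (3 * Real.pi) * |s μ + lRep n (k μ)| ≤ ‖dSym n k s μ‖ := by
  have hπ := Real.pi_pos
  have hn0 : n ≠ 0 := NeZero.ne n
  have hn : (0 : ℝ) < n := by exact_mod_cast Nat.pos_of_ne_zero hn0
  set x := s μ + lRep n (k μ) with hx
  have hm := two_mul_abs_mRep_le n (k μ)
  have hmR : 2 * |(mRep n (k μ) : ℝ)| ≤ n := by
    have : ((2 * |mRep n (k μ)| : ℤ) : ℝ) ≤ (n : ℤ) := by exact_mod_cast hm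
    simpa [Int.cast_abs] using this
  have hl : |lRep n (k μ)| = 2 * Real.pi * |(mRep n (k μ) : ℝ)| := by
    unfold lRep; rw [abs_mul, abs_of_pos (by positivity : (0 : ℝ) < 2 * Real.pi)]
  have hxle : |x| ≤ 3 * Real.pi / 4 * (2 * n) := by
    have h1 : |x| ≤ |s μ| + |lRep n (k μ)| := abs_add_le _ _
    rcases Nat.lt_or_ge n 2 with hn2 | hn2
    · have hn1 : n = 1 := by omega
      have hm0 : mRep n (k μ) = 0 := by
        have : |mRep n (k μ)| ≤ 0 := by omega
        exact abs_nonpos_iff.mp this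
      have hl0 : lRep n (k μ) = 0 := by unfold lRep; rw [hm0]; simp
      rw [hl0, abs_zero, add_zero] at h1
      subst hn1
      push_cast
      linarith
    · have hn2R : (2 : ℝ) ≤ n := by exact_mod_cast hn2
      have h2 : |lRep n (k μ)| ≤ Real.pi * n := by rw [hl]; nlinarith
      nlinarith
  have hwin : |x / (2 * n)| ≤ 3 * Real.pi / 4 := by
    rw [abs_div, abs_of_pos (by positivity : (0 : ℝ) < 2 * n), div_le_iff₀ (by positivity)]
    exact hxle
  have hsin := abs_sin_ge (x / (2 * n)) hwin
  rw [norm_dSym_eq_sin]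
  calc 2 / (3 * Real.pi) * |x| = 2 * n * (2 / (3 * Real.pi) * |x / (2 * n)|) := by
        rw [abs_div, abs_of_pos (by positivity : (0 : ℝ) < 2 * n)]; field_simp
    _ ≤ 2 * n * |Real.sin (x / (2 * n))| := mul_le_mul_of_nonneg_left hsin (by positivity)

/-- One factor of (1.36), first inequality: `|∂¹_μ(p′)/∂_μ(p′+l)| ≤ (3π/2)·|p′_μ|/|p′_μ + l_μ|` (value 1/1 at the removable
point). [cite: Balaban1984PropagatorsI, (1.36) p.24] -/
theorem norm_vSym_le_ratio (n : ℕ) [NeZero n] (k : Fin d → Fin n) (s : Fin d → ℝ) (μ : Fin d)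
    (hs : |s μ| ≤ Real.pi) : ‖vSym n k s μ‖ ≤ 3 * Real.pi / 2 * ratio136 (s μ) (lRep n (k μ)) := by
  have hπ := Real.pi_pos
  have hπ3 := Real.pi_gt_three
  have hn1 : 1 ≤ n := Nat.one_le_iff_ne_zero.mpr (NeZero.ne n)
  by_cases h0 : dSym n k s μ = 0
  · obtain ⟨hs0, hk0⟩ := (dSym_eq_zero_iff n hn1 k s μ hs).mp h0
    have hl : lRep n (k μ) = 0 := by unfold lRep; rw [(mRep_eq_zero_iff n (k μ)).mpr hk0]; simp
    have hv : vSym n k s μ = 1 := by unfold vSym; rw [if_pos h0]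
    rw [hv, hs0, hl]
    unfold ratio136
    norm_num
    linarith
  · have hv : vSym n k s μ = d1Sym s μ / dSym n k s μ := by unfold vSym; rw [if_neg h0]
    have hsl : s μ + lRep n (k μ) ≠ 0 := by
      intro h
      obtain ⟨hl0, hs0⟩ := lRep_eq_zero_of_add_eq_zero hs h
      have hk0 : k μ = 0 := by
        have : mRep n (k μ) = 0 := by
          unfold lRep at hl0
          have h2 : (mRep n (k μ) : ℝ) = 0 := by
            rcases mul_eq_zero.mp hl0 with h3 | h3
            · exfalso; linarith [mul_pos (two_pos : (0:ℝ) < 2) hπ]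
            · exact h3
          exact_mod_cast h2
        exact (mRep_eq_zero_iff n (k μ)).mp this
      exact h0 ((dSym_eq_zero_iff n hn1 k s μ hs).mpr ⟨hs0, hk0⟩)
    rw [hv, norm_div]
    unfold ratio136
    rw [if_neg hsl]
    -- the numerator step `|e^{ip′_μ} − 1| ≤ |p′_μ|` (`S₁(x) ≤ x²`; the same inequality is the tree's
    -- `B5G183Rate.norm_d1Sym_le`, not imported here to keep the NE-spine rate modules out of this file's closure)
    have hd1 : ‖d1Sym s μ‖ ≤ |s μ| := by
      have h1 : S1r (s μ) ≤ (s μ) ^ 2 := by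
        have := B4Strip.Sxir_le 1 (s μ)
        simpa [Sxir, S1r] using this
      have h2 : ‖d1Sym s μ‖ ^ 2 ≤ |s μ| ^ 2 := by rw [norm_d1Sym_sq, sq_abs]; exact h1
      exact (pow_le_pow_iff_left₀ (norm_nonneg _) (abs_nonneg _) two_ne_zero).mp h2
    have hdl := dSym_lower n k s μ hs
    have hpos : 0 < |s μ + lRep n (k μ)| := abs_pos.mpr hsl
    calc ‖d1Sym s μ‖ / ‖dSym n k s μ‖ ≤ |s μ| / (2 / (3 * Real.pi) * |s μ + lRep n (k μ)|) :=
          div_le_div₀ (abs_nonneg _) hd1 (by positivity) hdl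
      _ = 3 * Real.pi / 2 * (|s μ| / |s μ + lRep n (k μ)|) := by
          field_simp

/-- One factor of (1.36), second inequality: `|p′_μ|/|p′_μ + l_μ| ≤ 4π/(1 + |l_μ|)` (`|p′_μ| ≦ π`, `l_μ ∈ 2πℤ`).
[cite: Balaban1984PropagatorsI, (1.36) p.24] -/
theorem ratio136_le (n : ℕ) (j : Fin n) (s : ℝ) (hs : |s| ≤ Real.pi) :
    ratio136 s (lRep n j) ≤ 4 * Real.pi * (1 + |lRep n j|)⁻¹ := by
  have hπ := Real.pi_pos
  have hπ3 := Real.pi_gt_three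
  unfold ratio136
  split_ifs with h
  · obtain ⟨hl, -⟩ := lRep_eq_zero_of_add_eq_zero hs h
    rw [hl]
    norm_num
    linarith
  · by_cases hm : mRep n j = 0
    · have hl : lRep n j = 0 := by unfold lRep; rw [hm]; simp
      have hs0 : s ≠ 0 := by rw [hl, add_zero] at h; exact h
      rw [hl, add_zero, abs_zero, add_zero, inv_one, mul_one, div_self (abs_ne_zero.mpr hs0)]
      linarith
    · have hl : 2 * Real.pi ≤ |lRep n j| := by
        unfold lRep
        rw [abs_mul, abs_of_pos (by positivity : (0 : ℝ) < 2 * Real.pi)]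
        have h1 : (1 : ℝ) ≤ |(mRep n j : ℝ)| := by
          rw [← Int.cast_abs]; exact_mod_cast Int.one_le_abs hm
        nlinarith
      have hsl : |lRep n j| / 2 ≤ |s + lRep n j| := by
        have h1 := abs_sub_abs_le_abs_sub (lRep n j) (-s)
        rw [abs_neg, sub_neg_eq_add, add_comm] at h1
        linarith
      have hlpos : 0 < |lRep n j| := by linarith
      calc |s| / |s + lRep n j| ≤ Real.pi / (|lRep n j| / 2) := div_le_div₀ hπ.le hs (by positivity) hsl
        _ = 2 * Real.pi / |lRep n j| := by field_simp
        _ ≤ 4 * Real.pi / (1 + |lRep n j|) := by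
            rw [div_le_div_iff₀ hlpos (by positivity)]
            nlinarith
        _ = 4 * Real.pi * (1 + |lRep n j|)⁻¹ := div_eq_mul_inv _ _

/-- **(1.36) PROVED** with explicit «O(1)»: `C₁ = (3π/2)^d`, `C₂ = (4π)^d`. [cite: Balaban1984PropagatorsI, (1.36) p.24] -/
theorem ineq136Printed_holds (d : ℕ) : Ineq136Printed d := by
  refine ⟨(3 * Real.pi / 2) ^ d, (4 * Real.pi) ^ d, ?_⟩
  intro n _ k s hs
  constructor
  · unfold uSym
    rw [norm_prod]
    calc ∏ μ, ‖vSym n k s μ‖ ≤ ∏ μ, (3 * Real.pi / 2 * ratio136 (s μ) (lRep n (k μ))) :=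
          Finset.prod_le_prod (fun μ _ => norm_nonneg _) fun μ _ => norm_vSym_le_ratio n k s μ (hs μ)
      _ = (3 * Real.pi / 2) ^ d * ∏ μ, ratio136 (s μ) (lRep n (k μ)) := by
          rw [Finset.prod_mul_distrib, Finset.prod_const, Finset.card_univ, Fintype.card_fin]
  · calc ∏ μ, ratio136 (s μ) (lRep n (k μ)) ≤ ∏ μ, (4 * Real.pi * (1 + |lRep n (k μ)|)⁻¹) :=
          Finset.prod_le_prod (fun μ _ => ratio136_nonneg _ _) fun μ _ => ratio136_le n (k μ) (s μ) (hs μ)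
      _ = (4 * Real.pi) ^ d * ∏ μ, (1 + |lRep n (k μ)|)⁻¹ := by
          rw [Finset.prod_mul_distrib, Finset.prod_const, Finset.card_univ, Fintype.card_fin]

/-- `Δ₀(p′) ≤ d·π²` on the Brillouin zone. [cite: Balaban1984PropagatorsI, p.24 (sentence before (1.36))] -/
theorem Delta1r_le_d_pi_sq (s : Fin d → ℝ) (hs : ∀ μ, |s μ| ≤ Real.pi) : Delta1r 0 s ≤ d * Real.pi ^ 2 := by
  unfold Delta1r
  rw [add_zero]
  calc ∑ μ, S1r (s μ) ≤ ∑ _μ : Fin d, Real.pi ^ 2 := by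
        refine Finset.sum_le_sum fun μ _ => ?_
        have h1 : S1r (s μ) ≤ (s μ) ^ 2 := by
          have := B4Strip.Sxir_le 1 (s μ)
          simpa [Sxir, S1r] using this
        have h2 : (s μ) ^ 2 ≤ Real.pi ^ 2 := by
          rw [← sq_abs]; exact pow_le_pow_left₀ (abs_nonneg _) (hs μ) 2
        linarith
    _ = d * Real.pi ^ 2 := by rw [Finset.sum_const, Finset.card_univ, Fintype.card_fin, nsmul_eq_mul]

/-- `Δ(p′ + l) ≥ (4/(9π²))·Σ_μ (p′_μ + l_μ)²` (symmetric `l`). [cite: Balaban1984PropagatorsI, p.24 (sentence before (1.36))] -/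
theorem DeltaXir_shift_ge (n : ℕ) [NeZero n] (k : Fin d → Fin n) (s : Fin d → ℝ) (hs : ∀ μ, |s μ| ≤ Real.pi) :
    4 / (9 * Real.pi ^ 2) * ∑ μ, (s μ + lRep n (k μ)) ^ 2 ≤ DeltaXir n 0 (shiftr n k s) := by
  rw [B5Prop11Fiber.Delta_eq, Finset.mul_sum]
  refine Finset.sum_le_sum fun μ _ => ?_
  have h := dSym_lower n k s μ (hs μ)
  have h0 : 0 ≤ 2 / (3 * Real.pi) * |s μ + lRep n (k μ)| := by positivity
  have h2 := pow_le_pow_left₀ h0 h 2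
  calc 4 / (9 * Real.pi ^ 2) * (s μ + lRep n (k μ)) ^ 2 = (2 / (3 * Real.pi) * |s μ + lRep n (k μ)|) ^ 2 := by
        rw [mul_pow, sq_abs]; ring
    _ ≤ ‖dSym n k s μ‖ ^ 2 := h2

/-- **The p. 24 quotient bound PROVED** with the explicit «O(1)» `C = 18π⁴d + 4π²d + 1`.
[cite: Balaban1984PropagatorsI, p.24 (sentence before (1.36))] -/
theorem quotient24Printed_holds (d : ℕ) : Quotient24Printed d := by
  refine ⟨18 * Real.pi ^ 4 * d + 4 * Real.pi ^ 2 * d + 1, ?_⟩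
  intro n _ k s hs
  have hπ := Real.pi_pos
  have hπ3 := Real.pi_gt_three
  have hn1 : 1 ≤ n := Nat.one_le_iff_ne_zero.mpr (NeZero.ne n)
  set N := Delta1r 0 s with hN
  set D := DeltaXir n 0 (shiftr n k s) with hD
  set L2 := ∑ μ, lRep n (k μ) ^ 2 with hL2
  set C := 18 * Real.pi ^ 4 * d + 4 * Real.pi ^ 2 * d + 1 with hC
  have hd0 : (0 : ℝ) ≤ d := Nat.cast_nonneg d
  have hN0 : 0 ≤ N := B4Strip.Delta1r_nonneg 0 le_rfl s
  have hNle : N ≤ d * Real.pi ^ 2 := Delta1r_le_d_pi_sq s hs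
  have hND : N ≤ D := B5Prop11Leaves.Delta1r_le_DeltaXir_shift n hn1 k s
  have hL20 : 0 ≤ L2 := Finset.sum_nonneg fun μ _ => sq_nonneg _
  have hDlow := DeltaXir_shift_ge n k s hs
  have hsum : L2 / 2 - d * Real.pi ^ 2 ≤ ∑ μ, (s μ + lRep n (k μ)) ^ 2 := by
    have h1 : ∀ μ, lRep n (k μ) ^ 2 / 2 - Real.pi ^ 2 ≤ (s μ + lRep n (k μ)) ^ 2 := by
      intro μ
      have h2 : (s μ) ^ 2 ≤ Real.pi ^ 2 := by
        rw [← sq_abs]; exact pow_le_pow_left₀ (abs_nonneg _) (hs μ) 2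
      nlinarith [sq_nonneg (s μ + lRep n (k μ) + s μ)]
    calc L2 / 2 - d * Real.pi ^ 2 = ∑ μ, (lRep n (k μ) ^ 2 / 2 - Real.pi ^ 2) := by
          rw [Finset.sum_sub_distrib, Finset.sum_const, Finset.card_univ, Fintype.card_fin, nsmul_eq_mul,
            ← Finset.sum_div]
      _ ≤ ∑ μ, (s μ + lRep n (k μ)) ^ 2 := Finset.sum_le_sum fun μ _ => h1 μ
  have hC1 : 1 + L2 ≤ C ∨ 4 * Real.pi ^ 2 * d < L2 := by
    by_cases hcase : L2 ≤ 4 * Real.pi ^ 2 * d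
    · left; rw [hC]; nlinarith [pow_pos hπ 4]
    · right; exact not_le.mp hcase
  have hL1 : 0 < 1 + L2 := by linarith
  by_cases hD0 : D = 0
  · rw [hD0, div_zero]; positivity
  have hDpos : 0 < D := lt_of_le_of_ne (hN0.trans hND) (Ne.symm hD0)
  rw [div_le_iff₀ hDpos]
  rcases hC1 with h | h
  · -- small |l|: N ≤ D and 1 ≤ C/(1 + |l|²)
    have h1 : 1 ≤ C * (1 + L2)⁻¹ := by
      rw [← div_eq_mul_inv, le_div_iff₀ hL1, one_mul]; exact h
    calc N ≤ D := hND
      _ = 1 * D := (one_mul D).symm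
      _ ≤ C * (1 + L2)⁻¹ * D := mul_le_mul_of_nonneg_right h1 hDpos.le
  · -- large |l|: D ≥ L2/(9π²), N ≤ dπ²
    have hd1 : (1 : ℝ) ≤ d := by
      rcases Nat.eq_zero_or_pos d with hd | hd
      · subst hd
        exfalso
        have : L2 = 0 := by rw [hL2]; simp
        rw [this] at h; simp at h
      · exact_mod_cast hd
    have hL2ge : 4 * Real.pi ^ 2 ≤ L2 := by nlinarith
    have hDge : L2 ≤ 9 * Real.pi ^ 2 * D := by
      have h2 : 4 / (9 * Real.pi ^ 2) * (L2 / 2 - d * Real.pi ^ 2) ≤ D := by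
        calc 4 / (9 * Real.pi ^ 2) * (L2 / 2 - d * Real.pi ^ 2)
            ≤ 4 / (9 * Real.pi ^ 2) * ∑ μ, (s μ + lRep n (k μ)) ^ 2 :=
              mul_le_mul_of_nonneg_left hsum (by positivity)
          _ ≤ D := hDlow
      have h3 : L2 / 4 ≤ L2 / 2 - d * Real.pi ^ 2 := by nlinarith
      have h4 : 4 / (9 * Real.pi ^ 2) * (L2 / 4) ≤ D := le_trans (mul_le_mul_of_nonneg_left h3 (by positivity)) h2
      have h5 : 4 / (9 * Real.pi ^ 2) * (L2 / 4) = L2 / (9 * Real.pi ^ 2) := by field_simp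
      rw [h5, div_le_iff₀ (by positivity)] at h4
      linarith
    have key : N * (1 + L2) ≤ C * D := by
      have hL2one : 1 ≤ L2 := by nlinarith
      have h6a : N * (1 + L2) ≤ d * Real.pi ^ 2 * (1 + L2) := mul_le_mul_of_nonneg_right hNle hL1.le
      have h6b : d * Real.pi ^ 2 * (1 + L2) ≤ d * Real.pi ^ 2 * (2 * L2) :=
        mul_le_mul_of_nonneg_left (by linarith) (by positivity)
      have h6 : N * (1 + L2) ≤ d * Real.pi ^ 2 * (2 * L2) := h6a.trans h6b
      have h7 : d * Real.pi ^ 2 * (2 * L2) ≤ d * Real.pi ^ 2 * (2 * (9 * Real.pi ^ 2 * D)) := by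
        apply mul_le_mul_of_nonneg_left _ (by positivity); linarith
      have h8 : d * Real.pi ^ 2 * (2 * (9 * Real.pi ^ 2 * D)) = 18 * Real.pi ^ 4 * d * D := by ring
      have h9 : 18 * Real.pi ^ 4 * d * D ≤ C * D := by
        apply mul_le_mul_of_nonneg_right _ hDpos.le; rw [hC]; nlinarith [pow_pos hπ 2]
      linarith
    calc N = N * (1 + L2) * (1 + L2)⁻¹ := by field_simp
      _ ≤ C * D * (1 + L2)⁻¹ := mul_le_mul_of_nonneg_right key (inv_nonneg.mpr hL1.le)
      _ = C * (1 + L2)⁻¹ * D := by ring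

end SymbolBoundsProofs

/-! ## §3  The bundle: the printed statements of pp. 17–27 AS HYPOTHESES, BY NAME -/

section Bundle

variable {d : ℕ} (L : ℕ) (M : Fin d → ℕ) [NeZero L] [hM : ∀ μ, NeZero (M μ)]

/-- **BLOCK 43 BUNDLE — the printed statements of [Balaban1984PropagatorsI] Sects. A–D, pp. 17–27 AS HYPOTHESES, BY NAME**,
in page order, over the torus carriers of the tree's B5 files (`L` = block side, `M` = the periods of the unit lattice
`T₁^{(k)}`, level `0` of the tower `B5SectBStatements.towerM L M`; (1.45) over an abstract family `proj` of
`B5.ProjFormData`); one field per statement, each a reference to the declaration of record typing it (verbatim quotations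
in those declarations' docstrings): `p19` — p. 19 «We will prove later that the quadratic form ⟨∂A, ∂A⟩ is positive on the
subspace of A satisfying QA = 0, A(Γ_{y,x}) = 0, x∈B(y), y∈T_L^{(1)}» (`B5SectAStatements.ClaimP19`, every torus T₁ tiled by
L-blocks); `e114` — (1.14) (`B5SectBStatements.Eq114`); `e116` — (1.16) (`B5SectBStatements.Eq116`); `e117` — (1.17), every
`k` (`B5SectBStatements.Eq117`); `e119` — (1.19), every `k` (`B5SectBStatements.Eq119`; the p. 20 product form of its
`Z_{k,Ax}` is the tree's `B5Eq119ZProduct.eq119_prod`, not a member); `c122` — (1.22) «we will see that it is different from 0», every `k`,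
every `α > 0` (`B5SectBStatements.Claim122`); `e123` — (1.23), every `k` (`B5SectBStatements.Eq123`); `q24` — p. 24
«Δ₀(p′)/Δ(p′ + l) ≦ O(1)1/(1 + |l|²)» (`Quotient24Printed`, §2); `i136` — (1.36) (`Ineq136Printed`, §2); `b145` — p. 25
«We have bounds 0 < Q′_kG′_k²Q′_k* ≦ a⁻²» and p. 26 «there are positive constants γ₀, γ₁, in fact γ₀ dependent only on d,
γ₁ = a⁻², such that γ₀ ≦ Q′_kG′_k²Q′_k* ≦ γ₁» (`B5.Bounds145Printed`); `e147` — (1.47), every `k` (`B5Eq147Landau.Eq147`).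
Hypothesis slot only; `hyp_of`: every member but `b145` is PROVED (tree + §2b); `hyp_torusForm`: all of it at `a ≦ 1`.
[cite: Balaban1984PropagatorsI, p.19 (claim after (1.13)), (1.14) p.19, (1.16)–(1.17) p.20, (1.19) p.20, (1.22)–(1.23) p.21, (1.36) p.24, p.25–26 (bounds after (1.44)/(1.45)), (1.47) p.26] -/
structure Hyp {I : Type} (proj : I → B5.ProjFormData) : Prop where
  p19 : ∀ M₁ : Fin d → ℕ, (∀ i, 0 < M₁ i) → (∀ i, L ∣ M₁ i) → B5SectAStatements.ClaimP19 d L M₁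
  e114 : Eq114 L M
  e116 : Eq116 L M
  e117 : ∀ k : ℕ, Eq117 L M k
  e119 : ∀ k : ℕ, Eq119 L M k
  c122 : ∀ (k : ℕ) (α : ℝ), 0 < α → Claim122 L M k α
  e123 : ∀ k : ℕ, Eq123 L M k
  q24 : Quotient24Printed d
  i136 : Ineq136Printed d
  b145 : B5.Bounds145Printed proj
  e147 : ∀ k : ℕ, B5Eq147Landau.Eq147 L M k

variable {L M}

/-- **What is PROVED of the bundle** (d ≥ 2, every `L ≥ 1`, every torus, U = 1): EVERY member except the printed (1.45)
bounds `b145` — which is TRUE for `0 < a ≦ 1` (`B5Gamma1FailsLargeA.bounds145Printed_small_a`,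
`B5QGGQ145Gamma1.printed_bounds_small_a`) and FALSE as printed («γ₁ = a⁻²») for large `a`
(`B5Gamma1FailsLargeA.not_bounds145Printed_all_a`, cell GAPS G-B5-13), so it stays the one input: p. 19 by
`B5SectAStatements.claimP19_holds` (part II, Lemma 2.4), (1.14)/(1.16)/(1.17)/(1.19) by `B5Eq114Gauss.eq114_holds`/
`eq116_holds`/`eq117_holds`/`eq119_holds`, (1.22)/(1.23) by
`B5Eq123Torus.claim122`/`eq123_holds`, the p. 24 bounds by `quotient24Printed_holds`/`ineq136Printed_holds` (§2b), (1.47)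
by `B5Eq147Landau.eq147_holds`.  Bookkeeping. [cite: Balaban1984PropagatorsI, pp.19–26] -/
theorem hyp_of (hd : 2 ≤ d) {I : Type} {proj : I → B5.ProjFormData} (h145 : B5.Bounds145Printed proj) :
    Hyp L M proj where
  p19 := fun _ hM₁ hLM => B5SectAStatements.claimP19_holds hd (Nat.one_le_iff_ne_zero.mpr (NeZero.ne L)) hM₁ hLM
  e114 := B5Eq114Gauss.eq114_holds L M hd
  e116 := B5Eq114Gauss.eq116_holds L M hd
  e117 := B5Eq114Gauss.eq117_holds L M hd
  e119 := B5Eq114Gauss.eq119_holds L M hd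
  c122 := fun k _ hα => B5Eq123Torus.claim122 L M k hα
  e123 := B5Eq123Torus.eq123_holds L M hd
  q24 := quotient24Printed_holds d
  i136 := ineq136Printed_holds d
  b145 := h145
  e147 := B5Eq147Landau.eq147_holds L M hd

/-- **THE BUNDLE IS A THEOREM at the torus family of the tree** (d ≥ 2, every `L ≥ 1`, every unit-lattice torus `M`):
with the (1.45) family `B5Gamma1FailsLargeA.torusForm` indexed by `0 < a ≦ 1` (the paper: «we will take eventually a = 1»,
p. 25) every printed statement of pp. 17–27 bundled in `Hyp` HOLDS — non-vacuity witness for the consumers of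
`stmt-QuantumFields-20542` ∕ `20544`. [cite: Balaban1984PropagatorsI, p.25 («we will take eventually a = 1»), p.26] -/
theorem hyp_torusForm (hd : 2 ≤ d) :
    Hyp L M (fun a : {a : ℝ // 0 < a ∧ a ≤ 1} => B5Gamma1FailsLargeA.torusForm a.1) :=
  hyp_of hd B5Gamma1FailsLargeA.bounds145Printed_small_a

/-- Conversely, at the same family indexed by ALL `a > 0` the bundle is FALSE as printed (its `b145` member is —
`B5Gamma1FailsLargeA.not_bounds145Printed_all_a`): the printed value «γ₁ = a⁻²» must be read at `a ≤ 1` (cell GAPS G-B5-13;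
`B5.Bounds145` is the repaired, provable form). [cite: Balaban1984PropagatorsI, p.26 (sentence after (1.45))] -/
theorem not_hyp_torusForm_all_a :
    ¬ Hyp L M (fun a : {a : ℝ // 0 < a} => B5Gamma1FailsLargeA.torusForm a.1) :=
  fun h => B5Gamma1FailsLargeA.not_bounds145Printed_all_a h.b145

/-- The repaired (1.45) bounds follow from the bundle (`B5.bounds145_of_printed`). [cite: Balaban1984PropagatorsI, p.26 (sentence after (1.45))] -/
theorem Hyp.bounds145 {I : Type} {proj : I → B5.ProjFormData} (h : Hyp L M proj) : B5.Bounds145 proj :=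
  B5.bounds145_of_printed proj h.b145

end Bundle

end

end Literature.MathematicalPhysics.QuantumFieldTheory.Balaban1983to89.B5Carve43SectsADHyp
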